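import Summits.QuantumFields.YangMills.Theorems.BalabanUVNodesN15KingModelFreeRGSemigroup
import Summits.QuantumFields.YangMills.Theorems.BalabanUVNodesN15KingModelFreeRGBlockSpinStep
import HarnessLib

/-!
# BalabanUVNodes ∕ N15 — THE KING-MODEL RUNG, FREE-FIELD EDITION (PART Τ-j₂): **KING'S (2.15) `T_{a_k,L^k} ∘ T_{a_n,L^n} = T_{a_{k+n},L^{k+n}}`
# AS AN OPERATOR IDENTITY ON ALL INTEGRABLE DENSITIES**, by name on the tori `T₁^{(k)} = Π_μ ℤ∕(M₀L^m)` with King's rescaled averaging operators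
# `Q̃_k = (L^k)^{(d−2)∕2}Q_{L^k}` (`kingBlockAvgK`, part Τ-i₃) and King's constants `a_k = a(1−L⁻²)(1−L^{−2k})⁻¹` (`King1986.aK`): the composition law
# of the Gaussian constants IS the tree's `King1986.inv_aK_add`, the composite mean IS the `(k+n)`-fold mean (Track A, DAG node N15 = NE2; FAN-OUT v1.1 §N15 s3
# «KING-MODEL RUNG»; regen R453 (b))

HONEST FRAMING.  Count-neutral (cell `pub-ymgap`, seat `pub-ymgap-dag-n15-e` g20; `--supports stmt-QuantumFields-27366 --as helper` = K3⁸
`SpineGivenEndpointR13SepCoPHV`).  TEMPLATE LITERATURE, `A = 0`, SCALAR FIELD.  [King1986] §2.2 p. 653 (with [Ba 1] §2): the renormalization transformation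
`(T_{a,L}F)(ψ) = N_{a,L}∫dφ exp[−(a∕2)Σ_y|ψ(y) − (Q̃φ)(y)|²]F(φ)` and its composition law (2.15) `T_{a,L}^k = T_{a_k,L^k}`, used for the INTERACTING
measure (`S^{(k)} := −ln T_{a,L}^k e^{−S^{(0)}}`, (2.13)).  Part Τ-i₃ (`…FreeRGBlockSpinStep`) proved the step and (2.15) for the FREE-FIELD densities only
(its HONEST SCOPE (iv)); part Τ-j₁ (`…FreeRGSemigroup`) proved the generic operator law `T_α^{Q}∘T_β^{Q′} = T_γ^{QQ′}` on every integrable `F` for block maps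
with `QQᵀ = c·1`, `γ⁻¹ = α⁻¹ + cβ⁻¹`.  THIS FILE instantiates it on King's objects:
* §1 King's rescaled mean as a MATRIX acting by `mulVec` (`kingBlockAvgK_eq_mulVec`), and ★ `kingAvg_mul_transpose`: `Q̃_kQ̃_kᵀ = (L^k)^{−2}·1`
  (`(L^k)^{d−2}` from the (2.20) rescaling × `(L^k)^{−d}` from the tree's `Qmat_mul_transpose_Qmat`);
* §2 ★ `comp_const_eq_aK`: `(a_k⁻¹ + (L^k)^{−2}a_n⁻¹)⁻¹ = a_{k+n}` — the tree's `King1986.inv_aK_add` read as the Chapman–Kolmogorov constant;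
* §3 ★★★ `kingRG_semigroup` — **(2.15) ON DENSITIES**: for `L ≥ 2`, `a > 0`, `k, n ≥ 1`, every depth `m`, every INTEGRABLE `F` on the fields of
  `Π ℤ∕(M₀L^{m+k+n})` and every `ψ` on `Π ℤ∕(M₀L^m)`:
  `N_{a_k}∫dφ′ e^{−(a_k∕2)‖ψ−Q̃_kφ′‖²}·[N_{a_n}∫dφ e^{−(a_n∕2)‖φ′−Q̃_nφ‖²}F(φ)] = N_{a_{k+n}}∫dφ e^{−(a_{k+n}∕2)‖ψ−Q̃_k(Q̃_nφ)‖²}F(φ)`, `N_a = (a∕2π)^{|sites|∕2}`;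
* §4 ★ `kingBlockAvgK_comp`: the composite of the rescaled means IS the `(k+n)`-fold rescaled mean, `Q̃_k(Q̃_nφ) = Q̃_{k+n}(φ∘e)` along the relabelling
  `e : Π ℤ∕(M₀L^{m+(k+n)}) ≃ Π ℤ∕(M₀L^{m+k+n})` (`torCongr`; all maps preserve the integer coordinates, blocks by `⌊·∕L^k⌋∘⌊·∕L^n⌋ = ⌊·∕L^{k+n}⌋`), and
  ★★★ `kingRG_semigroup_kfold`: the right side rewritten as ONE transformation `T_{a_{k+n},L^{k+n}}` — King's (2.15) verbatim for `T_{a_k,L^k}∘T_{a_n,L^n}`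
  (the printed `T_{a,L}^k = T_{a_k,L^k}` is the case `k ↦ 1, n ↦ k−1` iterated; `a_1 = a`, `King1986.aK_one`); ★★ `kingRG_recursion`: for ANY integrable
  bare density `ρ₀` (interacting or not), King's DEFINITION `ρ_k := T_{a_k,L^k}ρ₀` (2.13) obeys the step-by-step recursion `T_{a,L}ρ_k = ρ_{1+k}`.
HONEST SCOPE: `A = 0`, one-component scalar, cubic tori, King's flat block mean (2.10) (Bałaban's covariant `Q(A)` not touched); `F` any Lebesgue-integrable
function of the fine field (the interacting densities qualify but none is constructed); the `k`-fold ITERATE `T_{a,L}∘⋯∘T_{a,L}` as a recursion is not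
spelled out (each application of `kingRG_semigroup` with `k = 1` absorbs one more step).  NOT Bałaban's objects; NOT a node discharge; nothing continuum-YM ∕ ℝ⁴
∕ OS ∕ mass-gap ∕ Clay.  0 `sorry`; NO definition; standard axioms.
Locators: [King1986] (2.10) p.653, (2.13)–(2.15) p.653, (2.20) p.654, (2.21) p.654; [Balaban1982Higgs1] §2 pp.608–612.
-/

noncomputable section

namespace Summit.QuantumFields.YangMills.BalabanUVNodes.N15KingModelRung.FreeField

open Real Finset Matrix MeasureTheory
open Literature.MathematicalPhysics.QuantumFieldTheory.Balaban1983to89.B5Prop11Plancherel (Tor fine)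
open Literature.MathematicalPhysics.QuantumFieldTheory.King1986 (aK aK_pos aK_one inv_aK_add)
open Literature.MathematicalPhysics.QuantumFieldTheory.King1986.Torus (Qmat Qmat_mul_transpose_Qmat blockOf val_blockOf torCongr val_torCongr)

variable {d : ℕ} (L : ℕ) [NeZero L] (M₀ : ℕ) [NeZero M₀]

/-! ## §1 King's rescaled mean as a matrix, and `Q̃_kQ̃_kᵀ = (L^k)^{−2}·1` -/

/-- King's rescaled `L^k`-block mean acts by the matrix `√s_k·(Q_{L^k} relabelled)`, `s_k = (L^k)^{d−2}`: `Q̃_kφ = (√s_k·Q_{L^k}∘e⁻¹)·φ`.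
[cite: King1986, (2.10) p.653, (2.20) p.654] -/
theorem kingBlockAvgK_eq_mulVec (m k : ℕ) (φ : Tor (cubeSide (d := d) M₀ L (m + k)) → ℝ) :
    kingBlockAvgK L M₀ m k φ
      = (Real.sqrt ((((L ^ k : ℕ) : ℝ) ^ d) / ((L ^ k : ℕ) : ℝ) ^ 2)
          • (Qmat (L ^ k) (cubeSide (d := d) M₀ L m)).submatrix id (torCongr (cubeSide_add (d := d) L M₀ m k)).symm) *ᵥ φ := by
  rw [kingBlockAvgK, Matrix.smul_mulVec, Matrix.submatrix_mulVec_equiv, Equiv.symm_symm, Function.comp_id]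

/-- ★ **`Q̃_kQ̃_kᵀ = (L^k)^{−2}·1`**: the rescaling `(L^k)^{d−2}` of (2.20) times `Q_{L^k}Q_{L^k}ᵀ = (L^k)^{−d}·1` (the tree's `Qmat_mul_transpose_Qmat`).
[cite: King1986, (2.10) p.653, (2.20) p.654] -/
theorem kingAvg_mul_transpose (hL : 2 ≤ L) (m k : ℕ) :
    (Real.sqrt ((((L ^ k : ℕ) : ℝ) ^ d) / ((L ^ k : ℕ) : ℝ) ^ 2)
          • (Qmat (L ^ k) (cubeSide (d := d) M₀ L m)).submatrix id (torCongr (cubeSide_add (d := d) L M₀ m k)).symm)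
        * (Real.sqrt ((((L ^ k : ℕ) : ℝ) ^ d) / ((L ^ k : ℕ) : ℝ) ^ 2)
          • (Qmat (L ^ k) (cubeSide (d := d) M₀ L m)).submatrix id (torCongr (cubeSide_add (d := d) L M₀ m k)).symm)ᵀ
      = ((((L ^ k : ℕ) : ℝ) ^ 2)⁻¹) • (1 : Matrix (Tor (cubeSide (d := d) M₀ L m)) (Tor (cubeSide (d := d) M₀ L m)) ℝ) := by
  have hN : (0 : ℝ) < ((L ^ k : ℕ) : ℝ) := by exact_mod_cast pow_pos (show 0 < L by omega) k
  have hs : 0 ≤ (((L ^ k : ℕ) : ℝ) ^ d) / ((L ^ k : ℕ) : ℝ) ^ 2 := by positivity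
  rw [Matrix.transpose_smul, Matrix.smul_mul, Matrix.mul_smul, smul_smul, Matrix.transpose_submatrix, Matrix.submatrix_mul_equiv,
    Qmat_mul_transpose_Qmat, Matrix.submatrix_id_id, smul_smul, Real.mul_self_sqrt hs]
  congr 1
  field_simp

/-! ## §2 The Chapman–Kolmogorov constant is King's `a_{k+n}` -/

variable {L M₀}

omit [NeZero L] in
/-- ★ **The composition law of King's Gaussian constants**: with `α = a_k`, `β = a_n`, `c = (L^k)^{−2}`,
`αβ∕(β + αc) = a_{k+n}` — the tree's `King1986.inv_aK_add` `a_{k+n}⁻¹ = a_k⁻¹ + L^{−2k}a_n⁻¹`. [cite: King1986, (2.13)–(2.15) p.653] -/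
theorem comp_const_eq_aK {a : ℝ} (ha : 0 < a) (hL : 2 ≤ L) {k n : ℕ} (hk : 1 ≤ k) (hn : 1 ≤ n) :
    aK a L k * aK a L n / (aK a L n + aK a L k * (((L ^ k : ℕ) : ℝ) ^ 2)⁻¹) = aK a L (k + n) := by
  have hL1 : (1 : ℝ) < L := by exact_mod_cast (show 1 < L by omega)
  have hL0 : (0 : ℝ) < L := by linarith
  have hak : 0 < aK a L k := aK_pos ha hL1 hk
  have han : 0 < aK a L n := aK_pos ha hL1 hn
  have hakn : 0 < aK a L (k + n) := aK_pos ha hL1 (by omega)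
  have h := inv_aK_add ha hL1 k n
  have hc : (((L ^ k : ℕ) : ℝ) ^ 2)⁻¹ = ((L : ℝ) ^ (2 * k))⁻¹ := by
    push_cast
    rw [← pow_mul, mul_comm]
  have hpow : (0 : ℝ) < (L : ℝ) ^ (2 * k) := pow_pos hL0 _
  rw [hc]
  have e : aK a L (k + n) = ((aK a L k)⁻¹ + ((L : ℝ) ^ (2 * k))⁻¹ * (aK a L n)⁻¹)⁻¹ := by rw [← h, inv_inv]
  rw [e]
  field_simp

/-! ## §3 ★★★ (2.15) on densities: `T_{a_k,L^k} ∘ T_{a_n,L^n}` is ONE Gaussian block-spin transformation with constant `a_{k+n}` -/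

/-- ★★★ **KING'S (2.15) AS AN OPERATOR IDENTITY ON ALL INTEGRABLE DENSITIES**: for `L ≥ 2`, `a > 0`, `k, n ≥ 1`, every depth `m`, every
Lebesgue-INTEGRABLE function `F` of the fields on `Π ℤ∕(M₀L^{m+k+n})` and every field `ψ` on `Π ℤ∕(M₀L^m)`,
`N_{a_k}∫dφ′ e^{−(a_k∕2)‖ψ − Q̃_kφ′‖²}·[N_{a_n}∫dφ e^{−(a_n∕2)‖φ′ − Q̃_nφ‖²}F(φ)] = N_{a_{k+n}}∫dφ e^{−(a_{k+n}∕2)‖ψ − Q̃_k(Q̃_nφ)‖²}F(φ)`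
(`N_a = (a∕2π)^{|sites|∕2}` King's mass-one constants, `Q̃_j = kingBlockAvgK` the rescaled means, `a_j = aK a L j`): `T_{a_k,L^k}(T_{a_n,L^n}F) = T F` with
`T` the Gaussian block-spin transformation of constant `a_{k+n}` and mean `Q̃_k∘Q̃_n` (= `Q̃_{k+n}`, §4) — for the INTERACTING densities as well as the free
ones. [cite: King1986, (2.13)–(2.15) p.653; Balaban1982Higgs1, §2 pp.608–612] -/
theorem kingRG_semigroup {a : ℝ} (ha : 0 < a) (hL : 2 ≤ L) (m : ℕ) {k n : ℕ} (hk : 1 ≤ k) (hn : 1 ≤ n)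
    {F : (Tor (cubeSide (d := d) M₀ L (m + k + n)) → ℝ) → ℝ} (hF : Integrable F) (ψ : Tor (cubeSide (d := d) M₀ L m) → ℝ) :
    Real.sqrt (aK a L k / (2 * π)) ^ Fintype.card (Tor (cubeSide (d := d) M₀ L m))
        * ∫ φ' : Tor (cubeSide (d := d) M₀ L (m + k)) → ℝ,
            Real.exp (-(1 / 2 : ℝ) * (aK a L k * ((ψ - kingBlockAvgK L M₀ m k φ') ⬝ᵥ (ψ - kingBlockAvgK L M₀ m k φ'))))
              * (Real.sqrt (aK a L n / (2 * π)) ^ Fintype.card (Tor (cubeSide (d := d) M₀ L (m + k)))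
                  * ∫ φ : Tor (cubeSide (d := d) M₀ L (m + k + n)) → ℝ,
                      Real.exp (-(1 / 2 : ℝ) * (aK a L n
                          * ((φ' - kingBlockAvgK L M₀ (m + k) n φ) ⬝ᵥ (φ' - kingBlockAvgK L M₀ (m + k) n φ)))) * F φ)
      = Real.sqrt (aK a L (k + n) / (2 * π)) ^ Fintype.card (Tor (cubeSide (d := d) M₀ L m))
          * ∫ φ : Tor (cubeSide (d := d) M₀ L (m + k + n)) → ℝ,
              Real.exp (-(1 / 2 : ℝ) * (aK a L (k + n)
                  * ((ψ - kingBlockAvgK L M₀ m k (kingBlockAvgK L M₀ (m + k) n φ))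
                      ⬝ᵥ (ψ - kingBlockAvgK L M₀ m k (kingBlockAvgK L M₀ (m + k) n φ))))) * F φ := by
  have hL1 : (1 : ℝ) < L := by exact_mod_cast (show 1 < L by omega)
  have hc : (0 : ℝ) ≤ (((L ^ k : ℕ) : ℝ) ^ 2)⁻¹ := by positivity
  have e := blockSpinOp_comp
    (Real.sqrt ((((L ^ k : ℕ) : ℝ) ^ d) / ((L ^ k : ℕ) : ℝ) ^ 2)
      • (Qmat (L ^ k) (cubeSide (d := d) M₀ L m)).submatrix id (torCongr (cubeSide_add (d := d) L M₀ m k)).symm)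
    (Real.sqrt ((((L ^ n : ℕ) : ℝ) ^ d) / ((L ^ n : ℕ) : ℝ) ^ 2)
      • (Qmat (L ^ n) (cubeSide (d := d) M₀ L (m + k))).submatrix id (torCongr (cubeSide_add (d := d) L M₀ (m + k) n)).symm)
    (aK_pos ha hL1 hk) (aK_pos ha hL1 hn) hc (kingAvg_mul_transpose L M₀ hL m k) hF ψ
  rw [comp_const_eq_aK ha hL hk hn] at e
  simp only [kingBlockAvgK_eq_mulVec]
  exact e

/-! ## §4 The composite mean is the `(k+n)`-fold mean; (2.15) verbatim -/

section Composite

variable (L M₀)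

omit [NeZero L] [NeZero M₀] in
/-- The two spellings of the finest depth: `M₀L^{m+(k+n)} = M₀L^{m+k+n}`. [folklore] -/
theorem cubeSide_assoc (m k n : ℕ) : ∀ μ, cubeSide (d := d) M₀ L (m + (k + n)) μ = cubeSide (d := d) M₀ L (m + k + n) μ := by
  intro μ
  rw [Nat.add_assoc]

/-- A point of the relabelled torus has the same integer coordinates. [folklore] -/
theorem val_torCongr_symm {K K' : Fin d → ℕ} (h : ∀ μ, K μ = K' μ) (x : Tor K') (μ : Fin d) :
    (((torCongr h).symm x) μ).val = (x μ).val := by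
  have := val_torCongr h ((torCongr h).symm x) μ
  rw [Equiv.apply_symm_apply] at this
  exact this.symm

/-- **King's rescaled mean, pointwise**: `(Q̃_kφ)(b) = √s_k·(L^k)^{−d}·Σ_{x : ⌊x∕L^k⌋ = b} φ(x)` — the sum over the fine points of the unit lattice
`Π ℤ∕(M₀L^{m+k})` whose integer coordinates floor-divide by `L^k` to those of `b`. [cite: King1986, (2.10) p.653, (2.20) p.654] -/
theorem kingBlockAvgK_apply (m k : ℕ) (φ : Tor (cubeSide (d := d) M₀ L (m + k)) → ℝ) (b : Tor (cubeSide (d := d) M₀ L m)) :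
    kingBlockAvgK L M₀ m k φ b
      = Real.sqrt ((((L ^ k : ℕ) : ℝ) ^ d) / ((L ^ k : ℕ) : ℝ) ^ 2) * ((((L ^ k : ℕ) : ℝ) ^ d)⁻¹
          * ∑ x : Tor (cubeSide (d := d) M₀ L (m + k)), if (∀ μ, (x μ).val / L ^ k = (b μ).val) then φ x else 0) := by
  rw [kingBlockAvgK, Pi.smul_apply, smul_eq_mul]
  congr 1
  simp only [Matrix.mulVec, dotProduct, Function.comp_apply]
  rw [← (torCongr (cubeSide_add (d := d) L M₀ m k)).symm.sum_comp, Finset.mul_sum]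
  refine Finset.sum_congr rfl fun x _ => ?_
  rw [Equiv.apply_symm_apply, Qmat]
  have hiff : blockOf (L ^ k) (cubeSide (d := d) M₀ L m) ((torCongr (cubeSide_add (d := d) L M₀ m k)).symm x) = b
      ↔ ∀ μ, (x μ).val / L ^ k = (b μ).val := by
    rw [funext_iff]
    refine forall_congr' fun μ => ?_
    rw [← (ZMod.val_injective _).eq_iff, val_blockOf, val_torCongr_symm]
  by_cases hb : ∀ μ, (x μ).val / L ^ k = (b μ).val
  · rw [if_pos (hiff.mpr hb), if_pos hb]
  · rw [if_neg (fun h' => hb (hiff.mp h')), if_neg hb, zero_mul, mul_zero]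

/-- The `L^n`-block of a fine point, read on the middle torus: the unique `y` with `⌊x∕L^n⌋ = y`. [cite: King1986, (2.10) p.653] -/
theorem floor_iff_eq_blockOf (m k n : ℕ) (x : Tor (cubeSide (d := d) M₀ L (m + k + n))) (y : Tor (cubeSide (d := d) M₀ L (m + k))) :
    (∀ μ, (x μ).val / L ^ n = (y μ).val)
      ↔ blockOf (L ^ n) (cubeSide (d := d) M₀ L (m + k)) ((torCongr (cubeSide_add (d := d) L M₀ (m + k) n)).symm x) = y := by
  rw [funext_iff]
  refine forall_congr' fun μ => ?_
  rw [← (ZMod.val_injective _).eq_iff, val_blockOf, val_torCongr_symm]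

/-- The middle sum collapses: `Σ_y [⌊y∕L^k⌋ = b]·[⌊x∕L^n⌋ = y] = [⌊x∕L^{k+n}⌋ = b]`. [cite: King1986, (2.10) p.653] -/
theorem sum_floor_floor (m k n : ℕ) (x : Tor (cubeSide (d := d) M₀ L (m + k + n))) (b : Tor (cubeSide (d := d) M₀ L m)) :
    (∑ y : Tor (cubeSide (d := d) M₀ L (m + k)),
        (if (∀ μ, (y μ).val / L ^ k = (b μ).val) then (1 : ℝ) else 0)
          * (if (∀ μ, (x μ).val / L ^ n = (y μ).val) then (1 : ℝ) else 0))
      = if (∀ μ, (x μ).val / L ^ (k + n) = (b μ).val) then 1 else 0 := by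
  simp_rw [floor_iff_eq_blockOf L M₀ m k n x]
  rw [Finset.sum_mul_boole]
  simp only [Finset.mem_univ, if_true]
  congr 1
  refine propext (forall_congr' fun μ => ?_)
  rw [val_blockOf, val_torCongr_symm, Nat.div_div_eq_div_mul, ← pow_add, add_comm n k]

omit [NeZero L] in
/-- The constants multiply: `√s_k(L^k)^{−d}·√s_n(L^n)^{−d} = √s_{k+n}(L^{k+n})^{−d}`. [cite: King1986, (2.20) p.654] -/
theorem avgConst_mul (hL : 2 ≤ L) (k n : ℕ) :
    Real.sqrt ((((L ^ k : ℕ) : ℝ) ^ d) / ((L ^ k : ℕ) : ℝ) ^ 2) * (((L ^ k : ℕ) : ℝ) ^ d)⁻¹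
        * (Real.sqrt ((((L ^ n : ℕ) : ℝ) ^ d) / ((L ^ n : ℕ) : ℝ) ^ 2) * (((L ^ n : ℕ) : ℝ) ^ d)⁻¹)
      = Real.sqrt ((((L ^ (k + n) : ℕ) : ℝ) ^ d) / ((L ^ (k + n) : ℕ) : ℝ) ^ 2) * (((L ^ (k + n) : ℕ) : ℝ) ^ d)⁻¹ := by
  have hL0 : (0 : ℝ) < L := by exact_mod_cast (show 0 < L by omega)
  have hsk : 0 ≤ (((L ^ k : ℕ) : ℝ) ^ d) / ((L ^ k : ℕ) : ℝ) ^ 2 := by positivity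
  have e1 : Real.sqrt ((((L ^ k : ℕ) : ℝ) ^ d) / ((L ^ k : ℕ) : ℝ) ^ 2) * Real.sqrt ((((L ^ n : ℕ) : ℝ) ^ d) / ((L ^ n : ℕ) : ℝ) ^ 2)
      = Real.sqrt ((((L ^ (k + n) : ℕ) : ℝ) ^ d) / ((L ^ (k + n) : ℕ) : ℝ) ^ 2) := by
    rw [← Real.sqrt_mul hsk]
    congr 1
    push_cast
    rw [pow_add]
    field_simp
    ring
  have e2 : (((L ^ k : ℕ) : ℝ) ^ d)⁻¹ * (((L ^ n : ℕ) : ℝ) ^ d)⁻¹ = (((L ^ (k + n) : ℕ) : ℝ) ^ d)⁻¹ := by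
    push_cast
    rw [pow_add, mul_pow, mul_inv]
  calc _ = (Real.sqrt ((((L ^ k : ℕ) : ℝ) ^ d) / ((L ^ k : ℕ) : ℝ) ^ 2) * Real.sqrt ((((L ^ n : ℕ) : ℝ) ^ d) / ((L ^ n : ℕ) : ℝ) ^ 2))
      * ((((L ^ k : ℕ) : ℝ) ^ d)⁻¹ * (((L ^ n : ℕ) : ℝ) ^ d)⁻¹) := by ring
    _ = _ := by rw [e1, e2]

/-- ★ **THE COMPOSITE OF KING'S RESCALED MEANS IS THE `(k+n)`-FOLD RESCALED MEAN**: `Q̃_k(Q̃_nφ) = Q̃_{k+n}(φ∘e)`, `e` the relabelling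
`Π ℤ∕(M₀L^{m+(k+n)}) ≃ Π ℤ∕(M₀L^{m+k+n})` (`⌊⌊x∕L^n⌋∕L^k⌋ = ⌊x∕L^{k+n}⌋`; `√s_k·√s_n = √s_{k+n}`, `(L^k)^{−d}(L^n)^{−d} = (L^{k+n})^{−d}`).
[cite: King1986, (2.10) p.653, (2.15) p.653, (2.20) p.654] -/
theorem kingBlockAvgK_comp (hL : 2 ≤ L) (m k n : ℕ) (φ : Tor (cubeSide (d := d) M₀ L (m + k + n)) → ℝ) :
    kingBlockAvgK L M₀ m k (kingBlockAvgK L M₀ (m + k) n φ)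
      = kingBlockAvgK L M₀ m (k + n) (φ ∘ torCongr (cubeSide_assoc (d := d) L M₀ m k n)) := by
  funext b
  rw [kingBlockAvgK_apply, kingBlockAvgK_apply]
  simp_rw [kingBlockAvgK_apply L M₀ (m + k) n φ]
  -- the right side, re-indexed by `e`
  have hR : (∑ x' : Tor (cubeSide (d := d) M₀ L (m + (k + n))),
        if (∀ μ, (x' μ).val / L ^ (k + n) = (b μ).val) then (φ ∘ torCongr (cubeSide_assoc (d := d) L M₀ m k n)) x' else 0)
      = ∑ x : Tor (cubeSide (d := d) M₀ L (m + k + n)), if (∀ μ, (x μ).val / L ^ (k + n) = (b μ).val) then φ x else 0 := by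
    refine Fintype.sum_equiv (torCongr (cubeSide_assoc (d := d) L M₀ m k n)) _ _ fun x' => ?_
    simp_rw [Function.comp_apply, val_torCongr]
  -- the left side: distribute and collapse the middle sum
  have hL' : (∑ y : Tor (cubeSide (d := d) M₀ L (m + k)),
        if (∀ μ, (y μ).val / L ^ k = (b μ).val) then
          Real.sqrt ((((L ^ n : ℕ) : ℝ) ^ d) / ((L ^ n : ℕ) : ℝ) ^ 2) * ((((L ^ n : ℕ) : ℝ) ^ d)⁻¹
            * ∑ x : Tor (cubeSide (d := d) M₀ L (m + k + n)), if (∀ μ, (x μ).val / L ^ n = (y μ).val) then φ x else 0)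
        else 0)
      = Real.sqrt ((((L ^ n : ℕ) : ℝ) ^ d) / ((L ^ n : ℕ) : ℝ) ^ 2) * ((((L ^ n : ℕ) : ℝ) ^ d)⁻¹
          * ∑ x : Tor (cubeSide (d := d) M₀ L (m + k + n)), if (∀ μ, (x μ).val / L ^ (k + n) = (b μ).val) then φ x else 0) := by
    -- write every `if P then t else 0` as `[P]·t`
    have step1 : ∀ y : Tor (cubeSide (d := d) M₀ L (m + k)),
        (if (∀ μ, (y μ).val / L ^ k = (b μ).val) then
          Real.sqrt ((((L ^ n : ℕ) : ℝ) ^ d) / ((L ^ n : ℕ) : ℝ) ^ 2) * ((((L ^ n : ℕ) : ℝ) ^ d)⁻¹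
            * ∑ x : Tor (cubeSide (d := d) M₀ L (m + k + n)), if (∀ μ, (x μ).val / L ^ n = (y μ).val) then φ x else 0)
          else 0)
        = Real.sqrt ((((L ^ n : ℕ) : ℝ) ^ d) / ((L ^ n : ℕ) : ℝ) ^ 2) * ((((L ^ n : ℕ) : ℝ) ^ d)⁻¹
          * ∑ x : Tor (cubeSide (d := d) M₀ L (m + k + n)),
              ((if (∀ μ, (y μ).val / L ^ k = (b μ).val) then (1 : ℝ) else 0)
                * (if (∀ μ, (x μ).val / L ^ n = (y μ).val) then (1 : ℝ) else 0)) * φ x) := by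
      intro y
      by_cases hy : ∀ μ, (y μ).val / L ^ k = (b μ).val
      · rw [if_pos hy]
        congr 2
        refine Finset.sum_congr rfl fun x _ => ?_
        rw [if_pos hy, one_mul, boole_mul]
      · rw [if_neg hy]
        simp only [if_neg hy, zero_mul, Finset.sum_const_zero, mul_zero]
    simp_rw [step1]
    rw [← Finset.mul_sum, ← Finset.mul_sum, Finset.sum_comm]
    congr 2
    refine Finset.sum_congr rfl fun x _ => ?_
    rw [← Finset.sum_mul, sum_floor_floor, boole_mul]
  rw [hL', hR]
  have hc := avgConst_mul (d := d) L hL k n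
  linear_combination (∑ x : Tor (cubeSide (d := d) M₀ L (m + k + n)),
    if (∀ μ, (x μ).val / L ^ (k + n) = (b μ).val) then φ x else 0) * hc

/-- ★★★ **KING'S (2.15) VERBATIM FOR `T_{a_k,L^k} ∘ T_{a_n,L^n}`**: the composite of the two renormalization transformations on every integrable density
is the ONE transformation `T_{a_{k+n},L^{k+n}}` — constant `a_{k+n}`, block `L^{k+n}`, rescaled mean `Q̃_{k+n}` (read through the relabelling of the
finest torus). [cite: King1986, (2.13)–(2.15) p.653] -/
theorem kingRG_semigroup_kfold {a : ℝ} (ha : 0 < a) (hL : 2 ≤ L) (m : ℕ) {k n : ℕ} (hk : 1 ≤ k) (hn : 1 ≤ n)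
    {F : (Tor (cubeSide (d := d) M₀ L (m + k + n)) → ℝ) → ℝ} (hF : Integrable F) (ψ : Tor (cubeSide (d := d) M₀ L m) → ℝ) :
    Real.sqrt (aK a L k / (2 * π)) ^ Fintype.card (Tor (cubeSide (d := d) M₀ L m))
        * ∫ φ' : Tor (cubeSide (d := d) M₀ L (m + k)) → ℝ,
            Real.exp (-(1 / 2 : ℝ) * (aK a L k * ((ψ - kingBlockAvgK L M₀ m k φ') ⬝ᵥ (ψ - kingBlockAvgK L M₀ m k φ'))))
              * (Real.sqrt (aK a L n / (2 * π)) ^ Fintype.card (Tor (cubeSide (d := d) M₀ L (m + k)))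
                  * ∫ φ : Tor (cubeSide (d := d) M₀ L (m + k + n)) → ℝ,
                      Real.exp (-(1 / 2 : ℝ) * (aK a L n
                          * ((φ' - kingBlockAvgK L M₀ (m + k) n φ) ⬝ᵥ (φ' - kingBlockAvgK L M₀ (m + k) n φ)))) * F φ)
      = Real.sqrt (aK a L (k + n) / (2 * π)) ^ Fintype.card (Tor (cubeSide (d := d) M₀ L m))
          * ∫ φ : Tor (cubeSide (d := d) M₀ L (m + k + n)) → ℝ,
              Real.exp (-(1 / 2 : ℝ) * (aK a L (k + n)
                  * ((ψ - kingBlockAvgK L M₀ m (k + n) (φ ∘ torCongr (cubeSide_assoc (d := d) L M₀ m k n)))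
                      ⬝ᵥ (ψ - kingBlockAvgK L M₀ m (k + n) (φ ∘ torCongr (cubeSide_assoc (d := d) L M₀ m k n)))))) * F φ := by
  rw [kingRG_semigroup ha hL m hk hn hF ψ]
  simp_rw [kingBlockAvgK_comp L M₀ hL m k n]

/-- ★★ **THE RENORMALIZATION-GROUP RECURSION FOR AN ARBITRARY MODEL** ((2.13) + (2.15)): with King's DEFINITION `ρ_k := T_{a_k,L^k}ρ₀` of the
level-`k` effective density of ANY integrable bare density `ρ₀` (interacting or not), ONE MORE STEP `T_{a,L}` (`a = a_1`, `King1986.aK_one`) produces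
`ρ_{1+k} = T_{a_{1+k},L^{1+k}}ρ₀`: `T_{a,L}(T_{a_k,L^k}ρ₀) = T_{a_{1+k},L^{1+k}}ρ₀` — the consistency of (2.13) with the step-by-step definition of the
effective actions `S^{(k)} = −ln ρ_k`. [cite: King1986, (2.13)–(2.15) p.653] -/
theorem kingRG_recursion {a : ℝ} (ha : 0 < a) (hL : 2 ≤ L) (m : ℕ) {k : ℕ} (hk : 1 ≤ k)
    {ρ₀ : (Tor (cubeSide (d := d) M₀ L (m + 1 + k)) → ℝ) → ℝ} (hρ : Integrable ρ₀) (ψ : Tor (cubeSide (d := d) M₀ L m) → ℝ) :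
    Real.sqrt (a / (2 * π)) ^ Fintype.card (Tor (cubeSide (d := d) M₀ L m))
        * ∫ φ' : Tor (cubeSide (d := d) M₀ L (m + 1)) → ℝ,
            Real.exp (-(1 / 2 : ℝ) * (a * ((ψ - kingBlockAvgK L M₀ m 1 φ') ⬝ᵥ (ψ - kingBlockAvgK L M₀ m 1 φ'))))
              * (Real.sqrt (aK a L k / (2 * π)) ^ Fintype.card (Tor (cubeSide (d := d) M₀ L (m + 1)))
                  * ∫ φ : Tor (cubeSide (d := d) M₀ L (m + 1 + k)) → ℝ,
                      Real.exp (-(1 / 2 : ℝ) * (aK a L k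
                          * ((φ' - kingBlockAvgK L M₀ (m + 1) k φ) ⬝ᵥ (φ' - kingBlockAvgK L M₀ (m + 1) k φ)))) * ρ₀ φ)
      = Real.sqrt (aK a L (1 + k) / (2 * π)) ^ Fintype.card (Tor (cubeSide (d := d) M₀ L m))
          * ∫ φ : Tor (cubeSide (d := d) M₀ L (m + 1 + k)) → ℝ,
              Real.exp (-(1 / 2 : ℝ) * (aK a L (1 + k)
                  * ((ψ - kingBlockAvgK L M₀ m (1 + k) (φ ∘ torCongr (cubeSide_assoc (d := d) L M₀ m 1 k)))
                      ⬝ᵥ (ψ - kingBlockAvgK L M₀ m (1 + k) (φ ∘ torCongr (cubeSide_assoc (d := d) L M₀ m 1 k)))))) * ρ₀ φ := by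
  have hL1 : (1 : ℝ) < L := by exact_mod_cast (show 1 < L by omega)
  have h := kingRG_semigroup_kfold (d := d) L M₀ ha hL m (k := 1) (n := k) le_rfl hk hρ ψ
  rw [aK_one hL1] at h
  exact h

end Composite

end Summit.QuantumFields.YangMills.BalabanUVNodes.N15KingModelRung.FreeField

end
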